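import Literature.AnabelianGeometry.EtaleTheta.Thm56SubdagStatements
import Literature.AnabelianGeometry.EtaleTheta.Discharge.Sec5Thm57Kummer
import Literature.AnabelianGeometry.EtaleTheta.Discharge.Sec5Thm56
import Literature.AnabelianGeometry.EtaleTheta.Discharge.Sec5RigidityGlue

/-!
# [EtTh] Prop. 5.5 / Thm. 5.6 (i) — sub-DAG derivations (PDF pp. 101–103 = printed 327–329)

Mochizuki, *The étale theta function …*, Publ. RIMS **45** (2009)
[cite: MochizukiEtTh2009, Thm 5.6 p.328 (PDF p.102)].  abc-iut cell, layer L2, §K row K4 (seat abc-iut-w5-d020 gen 2);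
PROOF-ONLY companion (no definitions) of `Thm56SubdagStatements.lean`, over abc-iut-L2-d4's
`Discharge/Sec5Thm57Kummer.lean` (`psiAut_biKummerDiff`), `Discharge/Sec5Thm56.lean`
(`cyclotomicRigidityPreserved_of` — Thm. 5.6 ⟸ {aΨ, haΨ, hlin, hpull, hreach, hρ, hBN}) and abc-iut-L2-t4's
`FrobenioidCyclotomicRigidity.lean`.

PROVED here:
* `transportAtBN_of` — sub-node **T56-L09**: abc-iut-L2-d4's binder `hBN` («`Ψ` does indeed transport the natural
  isomorphism … of Proposition 5.5 [for `S₂`] to the corresponding isomorphism for `T₂`», p.329 (PDF p.103)) from the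
  transport of the root up to a unit (d4 T1, normalised `D_c = 1`), `StrvTransport` (Thm. 4.4 (iv)), the bi-Kummer
  relations, and the three typed inputs T56-L09b (`UnitsCentralUnderLDelta`), T56-L09c (`DeltaTransportCompat`),
  T56-L09d (`UnitsPullSpec`), for a family that is Kummer-determined on `B_N` and functorial at `β`;
* `cyclotomicRigidityPreserved_of_sub` — sub-node **T56-A**: abc-iut-L2-t4's `CyclotomicRigidityPreserved Ψ ρ aΨ` (both
  clauses of Thm. 5.6) with `hBN` DISCHARGED by `transportAtBN_of`, the remaining binders exactly d4's.
HONEST FRAMING: kernel-checked implications between typed statements about the §5 data; nothing of [EtTh] is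
asserted unconditionally; typed ≠ discharged; no side taken on [IUTchIII] Cor. 3.12.
-/

namespace Literature.AnabelianGeometry.EtaleTheta

open CategoryTheory
open FrobenioidCyclotomicRigidity
open Literature.AlgebraicGeometry.Frobenioids

universe w v v' u u'

namespace ThetaFrobenioid

namespace Thm56Sub

variable {C : Type u} [Category.{v} C] {D : Type u'} [Category.{v'} D] {𝔉 : ThetaFrobenioid.{w} C D}

/-! ### Prop. 5.5 — the existence half assembled (P55-A) -/

section PropFiveFive

/-- The `(l·Δ_Θ) ⊗ ℤ/Nℤ`-transport is compositional, from the law `LDeltaMapComp` (P55-L06b).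
[cite: MochizukiEtTh2009, Prop 5.5 proof p.328 (PDF p.102)] -/
theorem lDeltaModNMap_comp (hLc : LDeltaMapComp 𝔉) {S T U : C} (φ : S ⟶ T) (ψ : T ⟶ U)
    (x : 𝔉.lDeltaModN S) : 𝔉.lDeltaModNMap (φ ≫ ψ) x = 𝔉.lDeltaModNMap ψ (𝔉.lDeltaModNMap φ x) := by
  induction x using QuotientGroup.induction_on with
  | H z =>
    change QuotientGroup.mk (𝔉.lDeltaMap (𝔉.base.map (φ ≫ ψ)) z) =
      QuotientGroup.mk (𝔉.lDeltaMap (𝔉.base.map ψ) (𝔉.lDeltaMap (𝔉.base.map φ) z))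
    rw [CategoryTheory.Functor.map_comp, hLc]
    rfl

/-- The `(l·Δ_Θ) ⊗ ℤ/Nℤ`-transport along an identity is the identity, from the law `LDeltaMapId` (P55-L06b).
[cite: MochizukiEtTh2009, Prop 5.5 proof p.328 (PDF p.102)] -/
theorem lDeltaModNMap_id (hLi : LDeltaMapId 𝔉) (S : C) (x : 𝔉.lDeltaModN S) :
    𝔉.lDeltaModNMap (𝟙 S) x = x := by
  induction x using QuotientGroup.induction_on with
  | H z =>
    change QuotientGroup.mk (𝔉.lDeltaMap (𝔉.base.map (𝟙 S)) z) = QuotientGroup.mk z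
    rw [CategoryTheory.Functor.map_id, hLi]
    rfl

/-- The cyclotome pull-back is (contravariantly) compositional, from the law `UnitsPullComp` (P55-L06b).
[cite: MochizukiEtTh2009, Prop 5.5 proof p.328 (PDF p.102)] -/
theorem muTorsionPull_comp (hUc : UnitsPullComp 𝔉) {S T U : C} (φ : S ⟶ T) (ψ : T ⟶ U) (M : ℕ)
    (u : 𝔉.muTorsion U M) :
    𝔉.muTorsionPull (φ ≫ ψ) M u = 𝔉.muTorsionPull φ M (𝔉.muTorsionPull ψ M u) := by
  apply Subtype.ext
  change ((𝔉.unitsPull (φ ≫ ψ) ⟨u.1, u.2.1⟩ : 𝔉.units S) : Aut S) =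
    ((𝔉.unitsPull φ ⟨(𝔉.unitsPull ψ ⟨u.1, u.2.1⟩ : 𝔉.units T).1,
      (𝔉.unitsPull ψ ⟨u.1, u.2.1⟩ : 𝔉.units T).2⟩ : 𝔉.units S) : Aut S)
  rw [hUc]
  rfl

/-- The cyclotome pull-back along an identity is the identity, from the law `UnitsPullId` (P55-L06b).
[cite: MochizukiEtTh2009, Prop 5.5 proof p.328 (PDF p.102)] -/
theorem muTorsionPull_id (hUi : UnitsPullId 𝔉) (S : C) (M : ℕ) (u : 𝔉.muTorsion S M) :
    𝔉.muTorsionPull (𝟙 S) M u = u := by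
  apply Subtype.ext
  change ((𝔉.unitsPull (𝟙 S) ⟨u.1, u.2.1⟩ : 𝔉.units S) : Aut S) = (u : Aut S)
  rw [hUi]
  rfl

/-- Composites of linear morphisms are linear (`deg_Fr` is multiplicative, [FrdI] Rmk. 1.1.1).
[cite: MochizukiEtTh2009, Prop 5.5 proof p.328 (PDF p.102)] -/
theorem isLinear_comp {S T U : C} {φ : S ⟶ T} {ψ : T ⟶ U} (hφ : 𝔉.IsLinear φ) (hψ : 𝔉.IsLinear ψ) :
    𝔉.IsLinear (φ ≫ ψ) := by
  change 𝔉.pre.degFr (φ ≫ ψ) = 1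
  rw [𝔉.pre.degFr_comp, show 𝔉.pre.degFr φ = 1 from hφ, show 𝔉.pre.degFr ψ = 1 from hψ, one_mul]

/-- **EtTh:Prop5.5/P55-A — the EXISTENCE half of Prop. 5.5, assembled** (proof pp.327–328 (PDF pp.101–102)):
from an isomorphism `ν : (l·Δ_Θ)_{B_N} ⊗ ℤ/Nℤ ⥲ μ_N(B_N)` at the `l·N`-codomain (the «natural isomorphism» of
Prop. 5.2 (iii), pinned to the Kummer class by P55-L03), the bijective transport data of P55-L05
(`BijectivelyReachableFromBN`: «linear morphisms `S″ → S` … which induce isomorphisms»), the independence of the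
transport of P55-L06 (`TransportIndependent ν`: «independent of the choice of … the linear morphisms») and the
functoriality laws of the stub transports (P55-L06b), there is a candidate rigidity family (abc-iut-L2-t4's
`RigidityFamily`) extending `ν` and «functorial with respect to … the linear morphisms of `(l, N)`-theta-saturated
objects» (`IsFunctorialLinear`): `ρ_S := μ-pull(φ_S)⁻¹ ∘ ν ∘ Δ-push(φ_S)⁻¹` for a chosen linear `φ_S : B_N → S`.
Together with P55-L03 (`isKummerDetermined_of_thetaPair`) and abc-iut-L2-t11's `cyclotomicRigidity_of` this
yields abc-iut-L2-t4's `CyclotomicRigidity` (Prop. 5.5) modulo the named inputs (`cyclotomicRigidity_of_sub`).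
[cite: MochizukiEtTh2009, Prop 5.5 p.327–328 (PDF pp.101–102)] -/
theorem rigidityFamily_exists_of (hB : 𝔉.IsThetaSaturated 𝔉.BN)
    (ν : 𝔉.lDeltaModN 𝔉.BN ≃* 𝔉.muTorsion 𝔉.BN 𝔉.N)
    (hreach : BijectivelyReachableFromBN 𝔉) (hind : TransportIndependent 𝔉 ν)
    (hUc : UnitsPullComp 𝔉) (hUi : UnitsPullId 𝔉) (hLc : LDeltaMapComp 𝔉) (hLi : LDeltaMapId 𝔉) :
    ∃ ρ : RigidityFamily 𝔉, (∀ x, ρ 𝔉.BN hB x = ν x) ∧ IsFunctorialLinear 𝔉 ρ := by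
  classical
  choose φ hlin hΔ hμ using hreach
  -- the two induced isomorphisms at a theta-saturated `S`
  let EΔ : ∀ S (hS : 𝔉.IsThetaSaturated S), 𝔉.lDeltaModN 𝔉.BN ≃* 𝔉.lDeltaModN S := fun S hS =>
    MulEquiv.ofBijective (𝔉.lDeltaModNMap (φ S hS)) (hΔ S hS)
  let Eμ : ∀ S (hS : 𝔉.IsThetaSaturated S), 𝔉.muTorsion S 𝔉.N ≃* 𝔉.muTorsion 𝔉.BN 𝔉.N := fun S hS =>
    MulEquiv.ofBijective (𝔉.muTorsionPull (φ S hS) 𝔉.N) (hμ S hS)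
  -- the transported family `ρ_S := μ-pull(φ_S)⁻¹ ∘ ν ∘ Δ-push(φ_S)⁻¹`
  let ρ : RigidityFamily 𝔉 := fun S hS => ((EΔ S hS).symm.trans ν).trans (Eμ S hS).symm
  -- its defining property, read through `φ_S`
  have hchar : ∀ S (hS : 𝔉.IsThetaSaturated S) (y : 𝔉.lDeltaModN S),
      𝔉.muTorsionPull (φ S hS) 𝔉.N (ρ S hS y) = ν ((EΔ S hS).symm y) := by
    intro S hS y
    change (Eμ S hS) ((Eμ S hS).symm (ν ((EΔ S hS).symm y))) = ν ((EΔ S hS).symm y)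
    rw [MulEquiv.apply_symm_apply]
  have hEΔ : ∀ S (hS : 𝔉.IsThetaSaturated S) (y : 𝔉.lDeltaModN S),
      𝔉.lDeltaModNMap (φ S hS) ((EΔ S hS).symm y) = y := fun S hS y =>
    (EΔ S hS).apply_symm_apply y
  refine ⟨ρ, ?_, ?_⟩
  · -- at `B_N`: compare the transport along `φ_{B_N}` with the transport along the identity (independence)
    intro x
    have key := hind 𝔉.BN hB (φ 𝔉.BN hB) (𝟙 𝔉.BN) (hlin 𝔉.BN hB) (𝔉.pre.degFr_id 𝔉.BN)
      ((EΔ 𝔉.BN hB).symm x) x (ρ 𝔉.BN hB x)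
      (by rw [hEΔ, lDeltaModNMap_id hLi]) (hchar 𝔉.BN hB x)
    rw [muTorsionPull_id hUi] at key
    exact key
  · -- functoriality for a linear `ψ : S → T`: independence at `T` between `φ_T` and `φ_S ≫ ψ`
    intro S T ψ hψ hS hT x
    set x₁ := (EΔ S hS).symm x with hx₁
    have hx : 𝔉.lDeltaModNMap (φ S hS) x₁ = x := hEΔ S hS x
    have key := hind T hT (φ T hT) (φ S hS ≫ ψ) (hlin T hT) (isLinear_comp (hlin S hS) hψ)
      ((EΔ T hT).symm (𝔉.lDeltaModNMap ψ x)) x₁ (ρ T hT (𝔉.lDeltaModNMap ψ x))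
      (by rw [hEΔ, lDeltaModNMap_comp hLc, hx]) (hchar T hT _)
    rw [muTorsionPull_comp hUc] at key
    -- `μ-pull(φ_S)` is injective: compare with `μ-pull(φ_S) (ρ_S x) = ν x₁`
    apply (hμ S hS).1
    rw [key, hchar S hS x]

/-- **EtTh:Prop5.5 — abc-iut-L2-t4's `CyclotomicRigidity P hB` (Prop. 5.5, existence ∧ uniqueness) DISCHARGED MODULO
the sub-DAG inputs**: the Prop. 5.2 (iii) pin `ThetaPairKummerClass η ν` (MERGE-PLAN row 6), `EtaTautological P η`
(P55-L02), `UnitsCentralUnderLDelta P` (P55-L02b), `BijectivelyReachableFromBN` (P55-L05), `TransportIndependent ν`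
(P55-L06), the transport laws (P55-L06b), and abc-iut-L2-t11's coverage `hcov` — by `rigidityFamily_exists_of` +
`isKummerDetermined_of_thetaPair` + abc-iut-L2-t11's `cyclotomicRigidity_of` (uniqueness via abc-iut-L2-t4's
`rigidityFamily_unique_of`).  [cite: MochizukiEtTh2009, Prop 5.5 p.327–328 (PDF pp.101–102)] -/
theorem cyclotomicRigidity_of_sub (P : ThetaSubquotientProj 𝔉) (hB : 𝔉.IsThetaSaturated 𝔉.BN)
    {η : 𝔉.HB → 𝔉.lDeltaModN 𝔉.BN} {ν : 𝔉.lDeltaModN 𝔉.BN ≃* 𝔉.muTorsion 𝔉.BN 𝔉.N}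
    (hK : FrobenioidThetaBiKummer.ThetaPairKummerClass 𝔉 η ν) (hη : EtaTautological 𝔉 P η)
    (hcentral : UnitsCentralUnderLDelta 𝔉 P) (hreach : BijectivelyReachableFromBN 𝔉)
    (hind : TransportIndependent 𝔉 ν) (hUc : UnitsPullComp 𝔉) (hUi : UnitsPullId 𝔉) (hLc : LDeltaMapComp 𝔉)
    (hLi : LDeltaMapId 𝔉) (hcov : LDeltaCovered 𝔉 P) : CyclotomicRigidity 𝔉 P hB := by
  obtain ⟨ρ, hρB, hρ⟩ := rigidityFamily_exists_of hB ν hreach hind hUc hUi hLc hLi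
  have hreach' : LinearlyReachableFromBN 𝔉 := fun S hS => by
    obtain ⟨φ, hφ, hΔ, hμ⟩ := hreach S hS
    exact ⟨φ, hφ, hΔ.2, hμ.1⟩
  exact 𝔉.cyclotomicRigidity_of P hB hreach' hcov
    ⟨ρ, isKummerDetermined_of_thetaPair 𝔉 P hK hη (cyclotomeCentral_of_unitsCentral 𝔉 hcentral) ρ hB hρB, hρ⟩

end PropFiveFive

/-! ### Thm. 5.6 — the transport at `B_N` (T56-L09), derived -/

section TransportAtBN

variable (Ψ : C ≌ C) (α : Ψ.functor.obj 𝔉.AN ≅ 𝔉.AN) (β : Ψ.functor.obj 𝔉.BN ≅ 𝔉.BN) (e : 𝔉.AN ≅ 𝔉.AN)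
  (Dp : Aut 𝔉.BN) (θ : Aut (𝔉.base.obj 𝔉.BN) ≃* Aut (𝔉.base.obj 𝔉.BN))

/-- `Ψ^Aut` in terms of `Ψ` on automorphisms: `Ψ^Aut = conj_β ∘ Ψ` (abc-iut-L2-t4's `psiAut`, Thm. 5.10 (ii)).
[cite: MochizukiEtTh2009, Thm 5.10 (ii) p.333 (PDF p.107)] -/
theorem psiAut_eq_conjAut (x : Aut 𝔉.BN) : 𝔉.psiAut Ψ β x = β.conjAut (Ψ.functor.mapAut 𝔉.BN x) := rfl

/-- **EtTh:Thm5.6(i)/T56-L09 — the transport of the rigidity isomorphism at `S₂ = B_N`, DERIVED** (p.329 (PDF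
p.103) l.17–23: «by forming the resulting group homomorphisms … [Prop. 4.3 (i)] and Kummer classes [Prop. 4.3
(iii)], and observing that the Kummer class of the "constant function" `u` does not affect the restriction of the
resulting Kummer classes to `(l·Δ_Θ)_{S₂}`, `(l·Δ_Θ)_{T₂}`, we conclude that `Ψ` does indeed transport the natural
isomorphism `(l·Δ_Θ)_{S₂} ⊗ ℤ/Nℤ ⥲ μ_N(S₂)` of Proposition 5.5 to the corresponding isomorphism for `T₂`»).  This is
EXACTLY abc-iut-L2-d4's binder `hBN` of `Discharge/Sec5Thm56.preservesRigidityIso_of` /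
`cyclotomicRigidityPreserved_of`.  Inputs, as printed: the transport of the root up to the unit `u = D_p` (abc-iut-L2-d4
T1 `Discharge/Sec5Thm57.exists_codTransport_of_div_eq`, normalised to `D_c = 1` by re-choosing `β` — «`γ₂ ∘ s′ = t′
∘ γ₁`, `u ∘ γ₂ ∘ s″ = t″ ∘ γ₁`»: `hT`, `hT'`, `hu`), the transport of `s^trv_N` over `θ` (abc-iut-L2-t4 `StrvTransport`,
Thm. 4.4 (iv): `hstrv`) with `θ(H_{B_N}) = H_{B_N}` (Prop. 2.4: `hYdd`), the defining relations of the bi-Kummer root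
and total epimorphicity (`hcap`, `hcup`, `Epi`), Prop. 4.3 (iii) (`hdiff`), the T56-L09b/c/d inputs, and for the
family `ρ`: Kummer-determined on `B_N` (Prop. 5.5), functorial for linear morphisms (at the isomorphism `β`), coverage.
The computation is abc-iut-L2-d4's `psiAut_biKummerDiff` (Discharge/Sec5Thm57Kummer) with the Kummer cocycle of `u`
killed on the `Δ`-part by T56-L09b.  [cite: MochizukiEtTh2009, Thm 5.6 proof p.329 (PDF p.103)] -/
theorem transportAtBN_of [Epi 𝔉.sCap] [Epi 𝔉.sCup] (hcap : 𝔉.SgpCapSpec) (hcup : 𝔉.SgpCupSpec)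
    (hdiff : 𝔉.BiKummerDifferenceMem)
    (hT : α.inv ≫ Ψ.functor.map 𝔉.sCap ≫ β.hom = e.hom ≫ 𝔉.sCap ≫ (1 : Aut 𝔉.BN).hom)
    (hT' : α.inv ≫ Ψ.functor.map 𝔉.sCup ≫ β.hom = e.hom ≫ 𝔉.sCup ≫ Dp.hom) (hu : Dp ∈ 𝔉.units 𝔉.BN)
    (hstrv : 𝔉.StrvTransport Ψ α e θ) (hYdd : 𝔉.HB.map θ.toMonoidHom = 𝔉.HB)
    (P : ThetaSubquotientProj 𝔉) (hcentral : UnitsCentralUnderLDelta 𝔉 P) (hspec : UnitsPullSpec 𝔉)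
    (aΨ : ∀ S : C, 𝔉.lDeltaModN S ≃* 𝔉.lDeltaModN (Ψ.functor.obj S))
    (hcompat : DeltaTransportCompat 𝔉 Ψ β aΨ θ P)
    (ρ : RigidityFamily 𝔉) (hB : 𝔉.IsThetaSaturated 𝔉.BN) (hK : IsKummerDetermined 𝔉 P ρ hB)
    (hρ : IsFunctorialLinear 𝔉 ρ) (hcov : LDeltaCovered 𝔉 P)
    (hΨB : 𝔉.IsThetaSaturated (Ψ.functor.obj 𝔉.BN)) (x : 𝔉.lDeltaModN 𝔉.BN) :
    (Ψ.functor.mapAut 𝔉.BN (ρ 𝔉.BN hB x : Aut 𝔉.BN) : Aut (Ψ.functor.obj 𝔉.BN)) =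
      ρ (Ψ.functor.obj 𝔉.BN) hΨB (aΨ 𝔉.BN x) := by
  -- write `x = [proj h]` for some `h ∈ H_{B_N}` over `(l·Δ_Θ)_{B_N}` (coverage)
  obtain ⟨h, hh, rfl⟩ := hcov x
  -- `θ h ∈ H_{B_N}` (Prop. 2.4) and `θ h` lies over `(l·Δ_Θ)_{B_N}` again, compatibly with `aΨ` (T56-L09c)
  have hθmem : θ (h : Aut (𝔉.base.obj 𝔉.BN)) ∈ 𝔉.HB := (mem_iff_of_map_equiv_eq hYdd _).mpr h.2
  obtain ⟨hθpre, hθeq⟩ := hcompat (h : Aut (𝔉.base.obj 𝔉.BN)) hh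
  set h₁ : 𝔉.HB := ⟨θ (h : Aut (𝔉.base.obj 𝔉.BN)), hθmem⟩ with hh₁
  have hθpre₁ : (h₁ : Aut (𝔉.base.obj 𝔉.BN)) ∈ P.pre (𝔉.base.obj 𝔉.BN) := hθpre
  have hθeq₁ : 𝔉.lDeltaModNMap β.hom (aΨ 𝔉.BN (QuotientGroup.mk (P.proj _ ⟨(h : Aut (𝔉.base.obj 𝔉.BN)), hh⟩)))
      = QuotientGroup.mk (P.proj _ ⟨(h₁ : Aut (𝔉.base.obj 𝔉.BN)), hθpre₁⟩) := hθeq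
  -- abc-iut-L2-d4's transport of the bi-Kummer difference (with `D_c = 1`), the Kummer cocycle of the
  -- unit `u = D_p` being trivial on the `Δ`-part (T56-L09b)
  have hbi := psiAut_biKummerDiff Ψ α β e (1 : Aut 𝔉.BN) Dp θ hcap hcup hT hT' hstrv hYdd h
  simp only [inv_one, one_mul, mul_one] at hbi
  have hbi₁ : 𝔉.psiAut Ψ β (𝔉.sgpCap (h : Aut (𝔉.base.obj 𝔉.BN)) * (𝔉.sgpCup h)⁻¹) =
      𝔉.sgpCap (h₁ : Aut (𝔉.base.obj 𝔉.BN)) * (𝔉.sgpCup h₁)⁻¹ *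
        (𝔉.sgpCup h₁ * Dp * (𝔉.sgpCup h₁)⁻¹ * Dp⁻¹) := hbi
  rw [sgpCup_comm_units_of 𝔉 hcentral hdiff h₁ hθpre₁ hu, mul_inv_cancel_right, mul_inv_cancel, mul_one]
    at hbi₁
  -- `ρ_{B_N}` at `h` and at `θ h` IS the bi-Kummer difference (Prop. 5.5, Kummer-determined on `B_N`)
  have hKh := hK h hh
  have hKθ := hK h₁ hθpre₁
  -- the right-hand side through the functoriality of `ρ` at the (linear) isomorphism `β` and T56-L09c
  have hfun := hρ β.hom (isLinear_iso_hom β) hΨB hB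
    (aΨ 𝔉.BN (QuotientGroup.mk (P.proj _ ⟨(h : Aut (𝔉.base.obj 𝔉.BN)), hh⟩)))
  rw [hθeq₁] at hfun
  rw [← hfun]
  -- compare inside `Aut_C(B_N)` after conjugating by `β` (T56-L09d: the unit pull-back along `β` is conjugation)
  apply β.conjAut.injective
  rw [muTorsionPull_iso_eq 𝔉 hspec β 𝔉.N, hKθ, ← psiAut_eq_conjAut, hKh, hbi₁]

end TransportAtBN


/-! ### Thm. 5.6 assembled (T56-A) -/

section Assembly

variable (Ψ : C ≌ C) (α : Ψ.functor.obj 𝔉.AN ≅ 𝔉.AN) (β : Ψ.functor.obj 𝔉.BN ≅ 𝔉.BN) (e : 𝔉.AN ≅ 𝔉.AN)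
  (Dp : Aut 𝔉.BN) (θ : Aut (𝔉.base.obj 𝔉.BN) ≃* Aut (𝔉.base.obj 𝔉.BN))

/-- **EtTh:Thm5.6(i)/T56-A — [EtTh] Theorem 5.6 (both clauses, abc-iut-L2-t4's `CyclotomicRigidityPreserved Ψ ρ aΨ`),
discharged modulo its cited inputs with the transport at `B_N` (`hBN`) DERIVED.**  Binders = abc-iut-L2-d4's
(`Ψbs`, `eΨ`, `aΨ`+`haΨ`, `hreach`, `hρ`, `hlin`, `hpull`) with `hBN` replaced by the inputs of `transportAtBN_of`
(root transport with `D_c = 1` and unit `D_p`, `StrvTransport`, `hYdd`, bi-Kummer relations, T56-L09b/c/d,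
`IsKummerDetermined`, coverage).  [cite: MochizukiEtTh2009, Thm 5.6 p.328–329 (PDF pp.102–103)] -/
theorem cyclotomicRigidityPreserved_of_sub [Epi 𝔉.sCap] [Epi 𝔉.sCup]
    (Ψbs : D ⥤ D) [Ψbs.Faithful] (eΨ : Ψ.functor ⋙ 𝔉.base ≅ 𝔉.base ⋙ Ψbs)
    (aΨ : ∀ S : C, 𝔉.lDeltaModN S ≃* 𝔉.lDeltaModN (Ψ.functor.obj S))
    (ρ : RigidityFamily 𝔉) (hB : 𝔉.IsThetaSaturated 𝔉.BN)
    (hreach : LinearlyReachableFromBN 𝔉) (hρ : IsFunctorialLinear 𝔉 ρ)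
    (hlin : PreFrobenioidData.PreservesMor Ψ.functor 𝔉.IsLinear 𝔉.IsLinear)
    (haΨ : ∀ {S T : C} (φ : S ⟶ T) (x : 𝔉.lDeltaModN S),
      aΨ T (𝔉.lDeltaModNMap φ x) = 𝔉.lDeltaModNMap (Ψ.functor.map φ) (aΨ S x))
    (hpull : ∀ {S T : C} (φ : S ⟶ T) (u : 𝔉.muTorsion T 𝔉.N)
      (hu : Ψ.functor.mapAut T (u : Aut T) ∈ 𝔉.muTorsion (Ψ.functor.obj T) 𝔉.N),
      Ψ.functor.mapAut S (𝔉.muTorsionPull φ 𝔉.N u : Aut S) =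
        (𝔉.muTorsionPull (Ψ.functor.map φ) 𝔉.N ⟨_, hu⟩ : Aut (Ψ.functor.obj S)))
    (hcap : 𝔉.SgpCapSpec) (hcup : 𝔉.SgpCupSpec) (hdiff : 𝔉.BiKummerDifferenceMem)
    (hT : α.inv ≫ Ψ.functor.map 𝔉.sCap ≫ β.hom = e.hom ≫ 𝔉.sCap ≫ (1 : Aut 𝔉.BN).hom)
    (hT' : α.inv ≫ Ψ.functor.map 𝔉.sCup ≫ β.hom = e.hom ≫ 𝔉.sCup ≫ Dp.hom) (hu : Dp ∈ 𝔉.units 𝔉.BN)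
    (hstrv : 𝔉.StrvTransport Ψ α e θ) (hYdd : 𝔉.HB.map θ.toMonoidHom = 𝔉.HB)
    (P : ThetaSubquotientProj 𝔉) (hcentral : UnitsCentralUnderLDelta 𝔉 P) (hspec : UnitsPullSpec 𝔉)
    (hcompat : DeltaTransportCompat 𝔉 Ψ β aΨ θ P) (hK : IsKummerDetermined 𝔉 P ρ hB)
    (hcov : LDeltaCovered 𝔉 P) :
    CyclotomicRigidityPreserved 𝔉 Ψ ρ aΨ :=
  cyclotomicRigidityPreserved_of Ψ Ψbs eΨ aΨ ρ hB hreach hρ hlin haΨ hpull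
    (fun hΨB x => transportAtBN_of Ψ α β e Dp θ hcap hcup hdiff hT hT' hu hstrv hYdd P hcentral hspec aΨ
      hcompat ρ hB hK hρ hcov hΨB x)

end Assembly

end Thm56Sub

end ThetaFrobenioid

end Literature.AnabelianGeometry.EtaleTheta
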